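import Summits.QuantumAdvantage.QuantumAdvantage.Theorems.PairLawB
import Summits.QuantumAdvantage.QuantumAdvantage.Theorems.LevelRankA

set_option linter.dupNamespace false
set_option linter.unusedSectionVars false

/-!
# NonDisperseRankA (lens 4, g29; (P7) of the (c0) road ASSEMBLED) — NON-DISPERSION ⟹ LOW RANK, modulo Sanders' Bogolyubov–Ruzsa lemma

Blocker `X = AbsorptionDial.NoPerfectPolyOdd` (item 28487); decomp-qadv lens 4, g29.  Composition of K3a/K3b (`PairLawA/B`: non-dispersion ⟹ the
symmetric level set `Ξ_h` is dense) with K4v (`LevelRankA`: a subspace of sparse dual vectors forces low rank) THROUGH the Bogolyubov–Ruzsa lemma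
for finite fields [Sanders2012 = arXiv:1011.0107, Theorem 20], taken here as the HYPOTHESIS `hBR` in its density form (the body of the Literature
fact `Literature.Combinatorics.Additive.bogolyubovRuzsaFiniteField` at the prime `p`, to be filed): a subspace `V ⊆ 2Ξ_h − 2Ξ_h ⊆ Ξ_{4h}` of
codimension `≤ C·(1 + log α⁻¹)⁴`.

* `nDual_sub_le`, `mem_levelSet_of_sum4` (`2Ξ_h − 2Ξ_h ⊆ Ξ_{4h}`);
* ★★ `rank_le_of_nonDisperse`: under the polynomial-size conditions of `levelSet_dense_explicit`, non-dispersion of the cross forms `c` forces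
  `rank (c) ≤ 8h + C·(1 + L·log p)⁴` — the `hQ` input of `InnerDegreeLawsK.offDiag_lowRank` ((P8), landed), with `r₀` polylogarithmic.

Supports stmt-QuantumAdvantage-28487 (record; the residual `X` is NOT claimed).
-/

open Finset Module

namespace Summit.QuantumAdvantage.QuantumAdvantage.Theorems.PairLaw

variable {p : ℕ} [Fact p.Prime] {ι : Type*} [Fintype ι] [DecidableEq ι] {K : ℕ}

/-- `n(ξ − ξ') ≤ n(ξ) + n(ξ')` -/
theorem nDual_sub_le (c : ι → Fin K → ZMod p) (ξ ξ' : Fin K → ZMod p) :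
    nDual c (ξ - ξ') ≤ nDual c ξ + nDual c ξ' := by
  rw [sub_eq_add_neg]
  exact (nDual_add_le c ξ (-ξ')).trans (by rw [nDual_neg])

/-- `2Ξ_h − 2Ξ_h ⊆ Ξ_{4h}`: a sum `a₁ + a₂ − a₃ − a₄` of level-`h` vectors has level `≤ 4h` -/
theorem nDual_sum4_le (c : ι → Fin K → ZMod p) (h : ℕ) {a₁ a₂ a₃ a₄ : Fin K → ZMod p}
    (h₁ : a₁ ∈ levelSet c h) (h₂ : a₂ ∈ levelSet c h) (h₃ : a₃ ∈ levelSet c h) (h₄ : a₄ ∈ levelSet c h) :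
    nDual c (a₁ + a₂ - a₃ - a₄) ≤ 4 * h := by
  unfold levelSet at h₁ h₂ h₃ h₄
  rw [mem_filter] at h₁ h₂ h₃ h₄
  have e1 := nDual_add_le c a₁ a₂
  have e2 := nDual_sub_le c (a₁ + a₂) a₃
  have e3 := nDual_sub_le c (a₁ + a₂ - a₃) a₄
  omega

/-- **(P7) ASSEMBLED — NON-DISPERSION ⟹ LOW RANK (modulo Bogolyubov–Ruzsa).**  `hBR` is the density form of Sanders' Bogolyubov–Ruzsa lemma
for `𝔽_p` with constant `C`; under the polynomial-size conditions `2(Kp+1)^w₂·4^|ι| ≤ E·p^L`, `E ≤ 2(Kp+1)^w₂·4^|ι|`, `2p²(Lp) ≤ h + 1`,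
more than `E` low-weight column pairs force `rank (c) ≤ 8h + C·(1 + L·log p)⁴`. -/
theorem rank_le_of_nonDisperse (C : ℝ) (hC : 0 ≤ C)
    (hBR : ∀ (n : ℕ) (A : Finset (Fin n → ZMod p)) (α : ℝ), 0 < α → α ≤ 1 → α * (p : ℝ) ^ n ≤ A.card →
      ∃ V : Submodule (ZMod p) (Fin n → ZMod p),
        ((n : ℝ) - finrank (ZMod p) V) ≤ C * (1 + Real.log (1 / α)) ^ 4 ∧
        ∀ v ∈ V, ∃ a₁ ∈ A, ∃ a₂ ∈ A, ∃ a₃ ∈ A, ∃ a₄ ∈ A, v = a₁ + a₂ - a₃ - a₄)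
    (hp2 : 2 ≤ p) (c : ι → Fin K → ZMod p) (w₂ E h L : ℕ)
    (hfail : E < (univ.filter fun xx : (ι → Bool) × (ι → Bool) =>
      (univ.filter fun j => diffMap c xx j ≠ 0).card < w₂).card)
    (hEL : 2 * (K * p + 1) ^ w₂ * 4 ^ Fintype.card ι ≤ E * p ^ L) (hE1 : E ≤ 2 * (K * p + 1) ^ w₂ * 4 ^ Fintype.card ι)
    (hEpos : 0 < E) (hh : 2 * p ^ 2 * (L * p) ≤ h + 1) :
    ((Matrix.of c).rank : ℝ) ≤ 8 * h + C * (1 + L * Real.log p) ^ 4 := by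
  classical
  set S : ℝ := 2 * ((K * p + 1) ^ w₂ : ℝ) * 4 ^ Fintype.card ι with hS
  have hSpos : 0 < S := by positivity
  have hdense := levelSet_dense_explicit hp2 c w₂ E h L hfail hEL hh
  -- density α := E / S
  set α : ℝ := (E : ℝ) / S with hα
  have hαpos : 0 < α := by positivity
  have hE1r : (E : ℝ) ≤ S := by rw [hS]; exact_mod_cast hE1
  have hα1 : α ≤ 1 := by rw [hα, div_le_one hSpos]; exact hE1r
  have hcard : α * (p : ℝ) ^ K ≤ (levelSet c h).card := by
    rw [hα, div_mul_eq_mul_div, div_le_iff₀ hSpos]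
    calc (E : ℝ) * (p : ℝ) ^ K ≤ S * (levelSet c h).card := by rw [hS]; exact hdense
      _ = ((levelSet c h).card : ℝ) * S := by ring
  obtain ⟨V, hcodim, hV⟩ := hBR K (levelSet c h) α hαpos hα1 hcard
  -- every vector of V has level ≤ 4h
  have hY : ∀ ξ ∈ V, (univ.filter fun i => ξ ⬝ᵥ c i ≠ 0).card ≤ 4 * h := by
    intro ξ hξ
    obtain ⟨a₁, h₁, a₂, h₂, a₃, h₃, a₄, h₄, rfl⟩ := hV ξ hξ
    exact nDual_sum4_le c h h₁ h₂ h₃ h₄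
  have hrank := LevelRank.rank_le_of_sparse_subspace V c (4 * h) hY
  -- 1/α ≤ p^L
  have hp0 : (0 : ℝ) < p := by exact_mod_cast (lt_of_lt_of_le (by norm_num) hp2 : 0 < p)
  have hp1 : (1 : ℝ) ≤ p := by exact_mod_cast (le_trans (by norm_num) hp2 : 1 ≤ p)
  have hinv : 1 / α ≤ (p : ℝ) ^ L := by
    rw [hα, one_div_div, div_le_iff₀ (by exact_mod_cast hEpos : (0 : ℝ) < E)]
    rw [hS, mul_comm ((p : ℝ) ^ L)]
    exact_mod_cast hEL
  have hlog : Real.log (1 / α) ≤ L * Real.log p := by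
    rw [← Real.log_pow]
    exact Real.log_le_log (by positivity) hinv
  have hlog0 : 0 ≤ Real.log (1 / α) := Real.log_nonneg (by rw [le_div_iff₀ hαpos]; linarith)
  have hmono : C * (1 + Real.log (1 / α)) ^ 4 ≤ C * (1 + L * Real.log p) ^ 4 := by
    apply mul_le_mul_of_nonneg_left _ hC
    exact pow_le_pow_left₀ (by linarith) (by linarith) 4
  have hfin : finrank (ZMod p) V ≤ K := by
    have := Submodule.finrank_le V
    rw [finrank_fintype_fun_eq_card, Fintype.card_fin] at this
    exact this
  have hcast : (((2 * (4 * h) + (K - finrank (ZMod p) V) : ℕ) : ℝ)) = 8 * h + ((K : ℝ) - finrank (ZMod p) V) := by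
    rw [Nat.cast_add, Nat.cast_sub hfin]
    push_cast
    ring
  have hr : ((Matrix.of c).rank : ℝ) ≤ 8 * h + ((K : ℝ) - finrank (ZMod p) V) := by
    rw [← hcast]
    exact_mod_cast hrank
  linarith

end Summit.QuantumAdvantage.QuantumAdvantage.Theorems.PairLaw
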